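import Literature.MathematicalPhysics.PowerSystems.LuriePostnikovSlabCertificate
import HarnessLib

/-!
# GridStability/Lyapunov/SlabPopovUpperBound — an UPPER bound of the Lur'e–Postnikov slab Lyapunov function on
# the closed slab: `∫₀^y F ≤ b·y²/2` per channel and `V(x) ≤ t·|x|²` from one PSD fact (generic)

Cell `gridfusion` (LADDER-GRIDFUSION G2.c lossy tier); seat gridfusion-lyap-2 (g0); rider material for the
REGION-SIZE readings of slab certificates (`Bench/WSCC9LossySplitSlabBall.lean`, #35″ SPLIT). Generic companions
of lit-6's `LuriePostnikovSlabCertificate.lean` (whose `popov_term_nonneg` / `le_V_of_slab` bound `V` from BELOW):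
* `popov_term_le` — on a sector `a ≤ cos ξ ≤ b` (`|ξ − δ*| ≤ γ`, `a ≤ b`) the Popov integral is bounded ABOVE,
  `cos δ* − cos(δ* + y) − y·sin δ* ≤ b·y²/2` for `|y| ≤ γ` (mean value theorem: `F(u) = sin(δ* + u) − sin δ*`
  lies between `a·u` and `b·u` by lit-6's `sector_of_cos_bounds`, so `u·(b·u − F(u)) ≥ 0`);
* `V_le_quad_of_slab` — for ANY `SlabCertificate` with sector facts `hsec` and `a_k ≤ b_k`:
  `V(x) ≤ xᵀPx + Σ_k λ_k b_k y_k²` on the closed slab (`y = Cx`);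
* `quadForm_P_add_CtDC` — `xᵀ(P + Cᵀ·diag(w)·C)x = xᵀPx + Σ_k w_k y_k²` (plumbing);
* `V_le_of_psd` — from ONE PSD fact `t·1 − (P + Cᵀ·diag(λb)·C) ⪰ 0`: `V(x) ≤ t·|x|²` on the closed slab, so the
  Euclidean ball `|x|² ≤ c/t` lies inside `{V ≤ c}` — the producer's «inner ball» datum made a kernel fact.
THREE COLUMNS: pure mathematics about the certificate class (MODELLED/CERTIFIED columns untouched); no instance,
no data; nothing here says a grid is stable.
-/

noncomputable section

open Set Real Matrix Finset
open Literature.MathematicalPhysics.PowerSystems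
open Literature.MathematicalPhysics.PowerSystems.LyapunovFunctionFamily

namespace Summit.Ventures.GridStability.Lyapunov.SlabPopovUpperBound

/-! ### A Popov UPPER bound on a sector (generic; mean value theorem) -/

/-- **The Popov integral is bounded above on a sector**: if `a ≤ cos ξ ≤ b` for `|ξ − δ*| ≤ γ` (`a ≤ b`),
then `∫₀^y F = cos δ* − cos(δ* + y) − y·sin δ* ≤ b·y²/2` for `|y| ≤ γ` (`F(u) = sin(δ* + u) − sin δ*` lies
between `a·u` and `b·u`, so `u·F(u) ≤ b·u²`; integrate). Twin of lit-6's `popov_term_nonneg`.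
[cite: Pai1981, §2.16 eq. (2.63) (the integral term); VuTuritsyn2017, §4.1 eq. (bound)] -/
theorem popov_term_le {δs γ a b : ℝ} (hab : a ≤ b)
    (hcos : ∀ ξ, |ξ - δs| ≤ γ → a ≤ Real.cos ξ ∧ Real.cos ξ ≤ b) {y : ℝ} (hy : |y| ≤ γ) :
    Real.cos δs - Real.cos (δs + y) - y * Real.sin δs ≤ b * y ^ 2 / 2 := by
  rcases eq_or_ne y 0 with h0 | h0
  · simp [h0]
  -- ψ(u) = b u²/2 − ∫₀^u F, ψ(0) = 0, ψ'(u) = b u − F(u), and u·ψ'(u) ≥ 0 on the slab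
  set ψ : ℝ → ℝ := fun u => b * u ^ 2 / 2 - (Real.cos δs - Real.cos (δs + u) - u * Real.sin δs) with hψ
  have hψd : ∀ u, HasDerivAt ψ (b * u - (Real.sin (δs + u) - Real.sin δs)) u := by
    intro u
    have h1 : HasDerivAt (fun u : ℝ => Real.cos (δs + u)) (-Real.sin (δs + u) * 1) u :=
      ((hasDerivAt_id u).const_add δs).cos
    have h2 : HasDerivAt (fun u : ℝ => u * Real.sin δs) (1 * Real.sin δs) u :=
      (hasDerivAt_id u).mul_const _
    have h3 : HasDerivAt (fun u : ℝ => b * u ^ 2 / 2) (b * ((2 : ℕ) * u ^ (2 - 1) * 1) / 2) u :=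
      (((hasDerivAt_id u).pow 2).const_mul b).div_const 2
    exact ((h3.sub (((hasDerivAt_const u (Real.cos δs)).sub h1).sub h2))).congr_deriv
      (by push_cast; ring)
  have hG : ∀ u, |u| ≤ γ → 0 ≤ u * (b * u - (Real.sin (δs + u) - Real.sin δs)) := by
    intro u hu
    rcases eq_or_ne u 0 with hu0 | hu0
    · simp [hu0]
    have hsec := sector_of_cos_bounds (a := a) (b := b) (δs := δs) (γ := γ) hcos hu
    set Fv := Real.sin (δs + u) - Real.sin δs with hFv
    rcases lt_or_gt_of_ne hu0 with hneg | hpos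
    · have hge : b * u ≤ Fv := by
        by_contra hc
        push Not at hc
        have h1 : Fv - b * u < 0 := by linarith
        have hab' : b * u ≤ a * u := by nlinarith
        have h2 : Fv - a * u < 0 := by linarith
        have : 0 < (Fv - a * u) * (Fv - b * u) := mul_pos_of_neg_of_neg h2 h1
        linarith
      nlinarith
    · have hle : Fv ≤ b * u := by
        by_contra hc
        push Not at hc
        have h1 : 0 < Fv - b * u := by linarith
        have hab' : a * u ≤ b * u := by nlinarith
        have h2 : 0 < Fv - a * u := by linarith
        have : 0 < (Fv - a * u) * (Fv - b * u) := mul_pos h2 h1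
        linarith
      nlinarith
  have hψ0 : ψ 0 = 0 := by simp [hψ]
  have hgoal : 0 ≤ ψ y := by
    rcases lt_or_gt_of_ne h0 with hneg | hpos
    · obtain ⟨ζ, hmem, hd⟩ := exists_hasDerivAt_eq_slope ψ (fun u => b * u - (Real.sin (δs + u) - Real.sin δs))
        hneg (HasDerivAt.continuousOn fun u _ => hψd u) (fun u _ => hψd u)
      have hζ : |ζ| ≤ γ := by
        rw [abs_le]; constructor <;> nlinarith [hmem.1, hmem.2, abs_le.1 hy]
      have hne : (0 : ℝ) - y ≠ 0 := by intro h; apply h0; linarith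
      rw [hψ0] at hd
      have hd' : (b * ζ - (Real.sin (δs + ζ) - Real.sin δs)) * (0 - y) = 0 - ψ y := by
        rw [hd, div_mul_cancel₀ _ hne]
      have hsgn : b * ζ - (Real.sin (δs + ζ) - Real.sin δs) ≤ 0 := by
        by_contra hc
        push Not at hc
        have : ζ * (b * ζ - (Real.sin (δs + ζ) - Real.sin δs)) < 0 := mul_neg_of_neg_of_pos hmem.2 hc
        linarith [hG ζ hζ]
      nlinarith [hmem.1, hmem.2]
    · obtain ⟨ζ, hmem, hd⟩ := exists_hasDerivAt_eq_slope ψ (fun u => b * u - (Real.sin (δs + u) - Real.sin δs))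
        hpos (HasDerivAt.continuousOn fun u _ => hψd u) (fun u _ => hψd u)
      have hζ : |ζ| ≤ γ := by
        rw [abs_le]; constructor <;> nlinarith [hmem.1, hmem.2, abs_le.1 hy]
      have hne : y - 0 ≠ 0 := by intro h; apply h0; linarith
      rw [hψ0] at hd
      have hd' : (b * ζ - (Real.sin (δs + ζ) - Real.sin δs)) * (y - 0) = ψ y - 0 := by
        rw [hd, div_mul_cancel₀ _ hne]
      have hsgn : 0 ≤ b * ζ - (Real.sin (δs + ζ) - Real.sin δs) := by
        by_contra hc
        push Not at hc
        have : ζ * (b * ζ - (Real.sin (δs + ζ) - Real.sin δs)) < 0 := mul_neg_of_pos_of_neg hmem.1 hc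
        linarith [hG ζ hζ]
      nlinarith [hmem.1, hmem.2]
  have : ψ y = b * y ^ 2 / 2 - (Real.cos δs - Real.cos (δs + y) - y * Real.sin δs) := rfl
  linarith

/-! ### `V` is bounded above by a quadratic form on the closed slab (generic) -/

section Generic

variable {ι κ : Type*} [Fintype ι] [Fintype κ] [DecidableEq ι] [DecidableEq κ]

/-- **Upper bound of the slab Lyapunov function on the closed slab**: with sector facts `hsec` and `a_k ≤ b_k`,
`V(x) = xᵀPx + 2Σ_k λ_k∫₀^{y_k}F_k ≤ xᵀPx + Σ_k λ_k b_k y_k²` (`y = Cx`, `|y_k| ≤ γ_k`).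
[cite: Pai1981, §2.16 eq. (2.63); VuTuritsyn2017, §4.3 (bounds of V on 𝒫)] -/
theorem V_le_quad_of_slab {S : System ι κ} (Λ : SlabCertificate S) {γ : κ → ℝ}
    (hsec : ∀ k ξ, |ξ - S.δs k| ≤ γ k → Λ.a k ≤ Real.cos ξ ∧ Real.cos ξ ≤ Λ.b k)
    (hab : ∀ k, Λ.a k ≤ Λ.b k) {x : ι → ℝ} (hx : ∀ k, |(S.C *ᵥ x) k| ≤ γ k) :
    Λ.V x ≤ x ⬝ᵥ (Λ.P *ᵥ x) + ∑ k, Λ.lam k * Λ.b k * (S.C *ᵥ x) k ^ 2 := by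
  unfold SlabCertificate.V SlabCertificate.popov
  have hk : ∀ k, Λ.lam k * (Real.cos (S.δs k) - Real.cos (S.δs k + (S.C *ᵥ x) k)
      - (S.C *ᵥ x) k * Real.sin (S.δs k)) ≤ Λ.lam k * (Λ.b k * (S.C *ᵥ x) k ^ 2 / 2) := fun k =>
    mul_le_mul_of_nonneg_left (popov_term_le (hab k) (hsec k) (hx k)) (Λ.lam_nonneg k)
  have hsum := Finset.sum_le_sum fun k (_ : k ∈ (univ : Finset κ)) => hk k
  have e : ∑ k, Λ.lam k * (Λ.b k * (S.C *ᵥ x) k ^ 2 / 2) = (∑ k, Λ.lam k * Λ.b k * (S.C *ᵥ x) k ^ 2) / 2 := by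
    rw [Finset.sum_div]
    exact Finset.sum_congr rfl fun k _ => by ring
  rw [e] at hsum
  linarith

omit [DecidableEq ι] in
/-- The quadratic form of `P + Cᵀ·diag(w)·C` is `xᵀPx + Σ_k w_k y_k²` (plumbing). [folklore] -/
theorem quadForm_P_add_CtDC {S : System ι κ} (P : Matrix ι ι ℝ) (w : κ → ℝ) (x : ι → ℝ) :
    x ⬝ᵥ ((P + S.Cᵀ * Matrix.diagonal w * S.C) *ᵥ x) = x ⬝ᵥ (P *ᵥ x) + ∑ k, w k * (S.C *ᵥ x) k ^ 2 := by
  have h : x ⬝ᵥ ((S.Cᵀ * (Matrix.diagonal w * S.C)) *ᵥ x) = ∑ k, w k * (S.C *ᵥ x) k ^ 2 := by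
    rw [← Matrix.mulVec_mulVec, Matrix.dotProduct_mulVec, Matrix.vecMul_transpose, ← Matrix.mulVec_mulVec]
    simp only [dotProduct, Matrix.mulVec_diagonal]
    exact Finset.sum_congr rfl fun k _ => by ring
  rw [Matrix.add_mulVec, dotProduct_add, Matrix.mul_assoc, h]

/-- **From a PSD fact `t·1 − (P + Cᵀ·diag(λb)·C) ⪰ 0`**: `V(x) ≤ t·|x|²` on the closed slab.
[cite: VuTuritsyn2017, §4.3 (bounds of V on 𝒫)] -/
theorem V_le_of_psd {S : System ι κ} (Λ : SlabCertificate S) {γ : κ → ℝ}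
    (hsec : ∀ k ξ, |ξ - S.δs k| ≤ γ k → Λ.a k ≤ Real.cos ξ ∧ Real.cos ξ ≤ Λ.b k)
    (hab : ∀ k, Λ.a k ≤ Λ.b k) {t : ℝ}
    (hpsd : (t • (1 : Matrix ι ι ℝ)
      - (Λ.P + S.Cᵀ * Matrix.diagonal (fun k => Λ.lam k * Λ.b k) * S.C)).PosSemidef)
    {x : ι → ℝ} (hx : ∀ k, |(S.C *ᵥ x) k| ≤ γ k) : Λ.V x ≤ t * (x ⬝ᵥ x) := by
  have h1 := V_le_quad_of_slab Λ hsec hab hx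
  have h2 := hpsd.dotProduct_mulVec_nonneg x
  rw [star_trivial, Matrix.sub_mulVec, dotProduct_sub, Matrix.smul_mulVec, Matrix.one_mulVec, dotProduct_smul,
    smul_eq_mul, quadForm_P_add_CtDC] at h2
  linarith

end Generic

end Summit.Ventures.GridStability.Lyapunov.SlabPopovUpperBound

end
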